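import Summits.AtomisticToContinuum.FouriersLaw.Theses.EmbeddedDrudeMourre
import Summits.AtomisticToContinuum.FouriersLaw.Theorems.DrudeDissolution.Negative.WeakAnharmonicityForm
import Summits.AtomisticToContinuum.FouriersLaw.Theorems.EmbeddedDrudeMourreMourreDissolutionSpectralWindow
import Summits.AtomisticToContinuum.FouriersLaw.Theorems.EmbeddedDrudeMourreFGRGap
import Literature.MathematicalPhysics.KineticTheory.ZeroWavenumberSpace
import Literature.MathematicalPhysics.KineticTheory.InfiniteChainInvariantStates
import Literature.MathematicalPhysics.KineticTheory.InfiniteChainSuperstableDynamics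
import Summits.AtomisticToContinuum.FouriersLaw.Theorems.EmbeddedDrudeMourreDrudeDissolutionStubGramContinuityExpectation
import Literature.MathematicalPhysics.KineticTheory.ChainMixingClustering
import Literature.MathematicalPhysics.KineticTheory.InfiniteChainGoodSetSymmetries
import HarnessLib

/-!
# Stub G `stub_gramContinuity` of line `gram-pencil-harmonic-chaos`, crux
`EmbeddedDrudeMourre.DrudeDissolution` (stmt-AtomisticToContinuum-12593; `--supports` file, closes nothing)

**The pencil's metric: uniform clustering and continuity in the coupling of the Gram form
`G_ε(u, v) = Σ_x Cov_{μ_ε}(u, v ∘ τ_x)` on local polynomials along the ray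
`ε ↦ P_ε = pinnedChain ω₂ (aε) (bε) 1`, `ε ∈ [0, 1]`, harmonic endpoint included.** For `ω₂ > 0`,
`a, b ≥ 0`, any family `ε ↦ μ_ε` of shift-invariant DLR states of `P_ε` at `T = 1` (there is exactly
one per `ε`) and all `u, v ∈ 𝒫 = Algebra.adjoin ℝ {σ ↦ q_x, σ ↦ p_x}`:
(i) `u ∈ L²(μ_ε)` with `∫ u² dμ_ε ≤ M` uniformly; (ii) `Σ_x |Cov_{μ_ε}(u, v ∘ τ_x)| ≤ C` uniformly;
(iii) `ε ↦ Σ_x Cov_{μ_ε}(u, v ∘ τ_x)` is continuous on `[0, 1]`.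

Proof (tools 1–7, files `…StubGramContinuity{EigenPerturbation, KernelFamily, UniformGap,
TransferData, MarkovState, UniformMoments, Expectation}.lean`). `μ_ε` is the two-sided stationary
Markov chain of the transfer operator of `P_ε` (`pencil_markov_state`); its Jentzsch gap is bounded
away from the top eigenvalue UNIFORMLY on the compact `[0, 1]` because the symmetrised transfer
operators form an operator-norm continuous family on one `L²` space (`top_eigenpair_perturbation`,
`kernel_family_local_gap`, `kernel_family_uniform_markov_gap`, `pencil_transfer_data`), whence
exponential `ρ`-mixing with `ε`-independent constants; with the uniform moment bounds
(`pencil_uniform_moments`) and the locality of `u, v` this gives (i) and the uniform summable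
majorant of (ii) (`abs_covariance_comp_chainShift_le_of_mixing_of_le`); each term
`Cov_{μ_ε}(u, v ∘ τ_x)` is a combination of expectations of local polynomials, continuous in `ε`
(`pencil_expectation_continuous`), and the majorant exchanges limit and sum (`continuousOn_tsum`).
-/

noncomputable section

namespace Summit.AtomisticToContinuum.FouriersLaw.Theorems.DrudeDissolution.GramPencilHarmonicChaos

open MeasureTheory Filter Set Function Topology
open scoped InnerProductSpace ENNReal ProbabilityTheory
open ProbabilityTheory
open Literature.MathematicalPhysics.KineticTheory
open Literature.MathematicalPhysics.KineticTheory.HeatConduction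
open Literature.MathematicalPhysics.KineticTheory.PhononBoltzmann

/-- The algebra of local polynomials is invariant under the lattice translations. [folklore] -/
private theorem polyObs_comp_chainShift_mem {f : ChainConfig → ℝ}
    (hf : f ∈ Algebra.adjoin ℝ (Set.range fun xc : ℤ × Bool =>
      fun σ : ChainConfig => if xc.2 then (σ xc.1).2 else (σ xc.1).1)) (x : ℤ) :
    f ∘ chainShift x ∈ Algebra.adjoin ℝ (Set.range fun xc : ℤ × Bool =>
      fun σ : ChainConfig => if xc.2 then (σ xc.1).2 else (σ xc.1).1) := by
  induction hf using Algebra.adjoin_induction with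
  | mem f hf =>
    obtain ⟨⟨y, bb⟩, rfl⟩ := hf
    refine Algebra.subset_adjoin ⟨(y + x, bb), ?_⟩
    funext σ
    cases bb <;> simp [chainShift_apply]
  | algebraMap r => exact Subalgebra.algebraMap_mem _ r
  | add f₁ f₂ _ _ ih₁ ih₂ => exact add_mem ih₁ ih₂
  | mul f₁ f₂ _ _ ih₁ ih₂ => exact mul_mem ih₁ ih₂

/-- The exponential tail `k ↦ e^{-m (k - c)₊}` is summable over `ℕ` (`m > 0`). [folklore] -/
private theorem summable_exp_neg_mul_tsub {m : ℝ} (hm : 0 < m) (c : ℕ) :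
    Summable fun k : ℕ => Real.exp (-(m * ((k - c : ℕ) : ℝ))) := by
  have hgeo : Summable fun k : ℕ => Real.exp (m * c) * Real.exp (-m) ^ k :=
    (summable_geometric_of_lt_one (Real.exp_nonneg _) (Real.exp_lt_one_iff.2 (by linarith))).mul_left _
  refine Summable.of_nonneg_of_le (fun k => (Real.exp_pos _).le) (fun k => ?_) hgeo
  rw [← Real.exp_nat_mul, ← Real.exp_add]
  refine Real.exp_le_exp.2 ?_
  have h1 : (k : ℝ) - c ≤ ((k - c : ℕ) : ℝ) := by
    rcases le_total c k with h | h
    · rw [Nat.cast_sub h]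
    · rw [Nat.sub_eq_zero_of_le h]; push_cast; linarith [(Nat.cast_le (α := ℝ)).2 h]
  nlinarith

/-- **STUB G** (M–L; static) of line `gram-pencil-harmonic-chaos`: **uniform clustering and
continuity in the coupling of the Gram form on local polynomials along the ray at `T = 1`** — for
`ω₂ > 0`, `a, b ≥ 0`, every family of shift-invariant DLR states `μ_ε` of
`pinnedChain ω₂ (aε) (bε) 1` at unit temperature, `ε ∈ [0, 1]`, and all local polynomials `u, v`:
(i) a uniform `L²` bound on `u`; (ii) `Σ_x |Cov_{μ_ε}(u, v ∘ τ_x)| ≤ C` uniformly in `ε`;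
(iii) continuity of `ε ↦ Σ_x Cov_{μ_ε}(u, v ∘ τ_x)` on `[0, 1]`.
[cite: Georgii2011, Thm 10.25 and §11.1] [cite: ReedSimonIV1978, Thm XIII.43 and Thm XIII.44] -/
theorem stub_gramContinuity :
    ∀ ω₂ a b : ℝ, 0 < ω₂ → 0 ≤ a → 0 ≤ b → ∀ μ : ℝ → MeasureTheory.Measure ChainConfig,
      (∀ ε ∈ Set.Icc (0 : ℝ) 1, (pinnedChain ω₂ (a * ε) (b * ε) 1).IsChainGibbsMeasure 1 (μ ε) ∧ IsShiftInvariant (μ ε)) →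
      ∀ u ∈ Algebra.adjoin ℝ (Set.range fun xc : ℤ × Bool => fun σ : ChainConfig => if xc.2 then (σ xc.1).2 else (σ xc.1).1),
      ∀ v ∈ Algebra.adjoin ℝ (Set.range fun xc : ℤ × Bool => fun σ : ChainConfig => if xc.2 then (σ xc.1).2 else (σ xc.1).1),
        (∃ M : ℝ, ∀ ε ∈ Set.Icc (0 : ℝ) 1, MeasureTheory.MemLp u 2 (μ ε) ∧ ∫ σ, (u σ) ^ 2 ∂(μ ε) ≤ M) ∧
        (∃ C : ℝ, ∀ ε ∈ Set.Icc (0 : ℝ) 1,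
          Summable (fun x : ℤ => |ProbabilityTheory.covariance u (v ∘ chainShift x) (μ ε)|) ∧
          ∑' x : ℤ, |ProbabilityTheory.covariance u (v ∘ chainShift x) (μ ε)| ≤ C) ∧
        ContinuousOn (fun ε : ℝ => ∑' x : ℤ, ProbabilityTheory.covariance u (v ∘ chainShift x) (μ ε))
          (Set.Icc (0 : ℝ) 1) := by
  intro ω₂ a b hω ha hb μ hμ u hu v hv
  classical
  have hprob : ∀ ε ∈ Set.Icc (0 : ℝ) 1, IsProbabilityMeasure (μ ε) := fun ε hε => (hμ ε hε).1.1
  have hτ : ∀ ε ∈ Set.Icc (0 : ℝ) 1, ∀ x : ℤ, MeasurePreserving (chainShift x) (μ ε) (μ ε) :=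
    fun ε hε x => (hμ ε hε).2.measurePreserving_chainShift x
  -- uniform mixing
  obtain ⟨lam, h, B, m, lmin, hm, -, -, -, hall⟩ := pencil_markov_state' hω ha hb
  have hmix : ∀ ε ∈ Set.Icc (0 : ℝ) 1, ∀ (a₀ : ℤ) (n : ℕ) (f g : ChainConfig → ℝ),
      DependsOn f {i : ℤ | i ≤ a₀} → DependsOn g {i : ℤ | a₀ + n ≤ i} → Measurable f → Measurable g →
      MemLp f 2 (μ ε) → MemLp g 2 (μ ε) →
      |∫ σ, f σ * g σ ∂(μ ε) - (∫ σ, f σ ∂(μ ε)) * ∫ σ, g σ ∂(μ ε)| ≤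
        2 * Real.exp (-(m * n)) * (∫ σ, f σ ^ 2 ∂(μ ε)) ^ (1 / 2 : ℝ) *
          (∫ σ, g σ ^ 2 ∂(μ ε)) ^ (1 / 2 : ℝ) :=
    fun ε hε => ((hall ε hε).2.2.2.2 (μ ε) (hμ ε hε).1 (hμ ε hε).2).2
  -- uniform moments, locality, measurability
  obtain ⟨hum, humom⟩ := pencil_uniform_moments' hω ha hb hμ hu
  obtain ⟨hvm, hvmom⟩ := pencil_uniform_moments' hω ha hb hμ hv
  obtain ⟨Mu, hMu⟩ := humom 2
  obtain ⟨Mv, hMv⟩ := hvmom 2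
  obtain ⟨Ru, hud⟩ := exists_dependsOn_of_mem_polyObs hu
  obtain ⟨Rv, hvd⟩ := exists_dependsOn_of_mem_polyObs hv
  have hsq : ∀ (f : ChainConfig → ℝ) (σ : ChainConfig), |f σ| ^ 2 = f σ ^ 2 := fun f σ => sq_abs _
  have hu2 : ∀ ε ∈ Set.Icc (0 : ℝ) 1, MemLp u 2 (μ ε) ∧ ∫ σ, u σ ^ 2 ∂(μ ε) ≤ Mu := by
    intro ε hε
    obtain ⟨hint, hle⟩ := hMu ε hε
    simp only [hsq] at hint hle
    exact ⟨(memLp_two_iff_integrable_sq hum.aestronglyMeasurable).2 hint, hle⟩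
  have hv2 : ∀ ε ∈ Set.Icc (0 : ℝ) 1, MemLp v 2 (μ ε) ∧ ∫ σ, v σ ^ 2 ∂(μ ε) ≤ Mv := by
    intro ε hε
    obtain ⟨hint, hle⟩ := hMv ε hε
    simp only [hsq] at hint hle
    exact ⟨(memLp_two_iff_integrable_sq hvm.aestronglyMeasurable).2 hint, hle⟩
  have hMu0 : 0 ≤ Mu := by
    obtain ⟨-, hle⟩ := hu2 0 ⟨le_rfl, zero_le_one⟩
    exact (integral_nonneg fun σ => sq_nonneg _).trans hle
  have hMv0 : 0 ≤ Mv := by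
    obtain ⟨-, hle⟩ := hv2 0 ⟨le_rfl, zero_le_one⟩
    exact (integral_nonneg fun σ => sq_nonneg _).trans hle
  -- the uniform summable majorant
  set Φ : ℕ → ℝ := fun k => (2 * Real.exp (-(m * ((k - Ru - Rv : ℕ) : ℝ))) +
    (if k < Ru + Rv then 1 else 0)) * (Real.sqrt Mu * Real.sqrt Mv) with hΦ
  set F : ℤ → ℝ := fun x => Φ x.natAbs with hF
  have hΦs : Summable Φ := by
    have h1 : Summable fun k : ℕ => 2 * Real.exp (-(m * ((k - Ru - Rv : ℕ) : ℝ))) := by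
      have := (summable_exp_neg_mul_tsub hm (Ru + Rv)).mul_left 2
      refine this.congr fun k => ?_
      have : k - (Ru + Rv) = k - Ru - Rv := by omega
      rw [this]
    have h2 : Summable fun k : ℕ => (if k < Ru + Rv then 1 else (0 : ℝ)) := by
      refine summable_of_ne_finset_zero (s := Finset.range (Ru + Rv)) fun k hk => ?_
      rw [Finset.mem_range] at hk
      exact if_neg hk
    exact (h1.add h2).mul_right _
  have hFs : Summable F := summable_int_comp_natAbs hΦs
  have hbound : ∀ ε ∈ Set.Icc (0 : ℝ) 1, ∀ x : ℤ, |cov[u, v ∘ chainShift x; μ ε]| ≤ F x := by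
    intro ε hε x
    haveI := hprob ε hε
    obtain ⟨hu2ε, hule⟩ := hu2 ε hε
    obtain ⟨hv2ε, hvle⟩ := hv2 ε hε
    have hsu : Real.sqrt (∫ σ, u σ ^ 2 ∂(μ ε)) ≤ Real.sqrt Mu := Real.sqrt_le_sqrt hule
    have hsv : Real.sqrt (∫ σ, v σ ^ 2 ∂(μ ε)) ≤ Real.sqrt Mv := Real.sqrt_le_sqrt hvle
    have htriv : |cov[u, v ∘ chainShift x; μ ε]| ≤ Real.sqrt Mu * Real.sqrt Mv := by
      have hvx : MemLp (v ∘ chainShift x) 2 (μ ε) := hv2ε.comp_measurePreserving (hτ ε hε x)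
      refine (abs_covariance_le_sqrt_mul_sqrt hu2ε hvx).trans ?_
      rw [integral_sq_comp_eq (hτ ε hε x) hv2ε.aestronglyMeasurable]
      exact mul_le_mul hsu hsv (Real.sqrt_nonneg _) (Real.sqrt_nonneg _)
    rw [hF, hΦ]; dsimp only
    by_cases hsmall : x.natAbs < Ru + Rv
    · rw [if_pos hsmall]
      have : 0 ≤ 2 * Real.exp (-(m * ((x.natAbs - Ru - Rv : ℕ) : ℝ))) * (Real.sqrt Mu * Real.sqrt Mv) := by
        positivity
      nlinarith
    · rw [if_neg hsmall, add_zero]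
      have hw : ((0 : ℕ) : ℤ) + Ru + Rv ≤ |x| := by
        have h1 : Ru + Rv ≤ x.natAbs := not_lt.1 hsmall
        have h2 : ((Ru + Rv : ℕ) : ℤ) ≤ (x.natAbs : ℤ) := by exact_mod_cast h1
        rw [Int.natCast_natAbs] at h2
        push_cast at h2 ⊢
        linarith
      have hvd' : DependsOn v (Set.Icc (-((0 : ℕ) : ℤ) - Rv) ((0 : ℕ) + Rv)) := by
        simpa using hvd
      have key := abs_covariance_comp_chainShift_le_of_mixing_of_le (hτ ε hε) (hmix ε hε) hud hum
        hu2ε hvd' hvm hv2ε hw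
      have e : (x.natAbs - 0 - Ru - Rv : ℕ) = x.natAbs - Ru - Rv := by omega
      rw [e] at key
      refine key.trans ?_
      have h0 : 0 ≤ Real.exp (-(m * ((x.natAbs - Ru - Rv : ℕ) : ℝ))) := (Real.exp_pos _).le
      calc 2 * Real.exp (-(m * ((x.natAbs - Ru - Rv : ℕ) : ℝ))) * Real.sqrt (∫ σ, u σ ^ 2 ∂(μ ε)) *
            Real.sqrt (∫ σ, v σ ^ 2 ∂(μ ε))
          ≤ 2 * Real.exp (-(m * ((x.natAbs - Ru - Rv : ℕ) : ℝ))) * Real.sqrt Mu * Real.sqrt Mv := by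
            gcongr
        _ = 2 * Real.exp (-(m * ((x.natAbs - Ru - Rv : ℕ) : ℝ))) * (Real.sqrt Mu * Real.sqrt Mv) := by
            ring
  refine ⟨⟨Mu, hu2⟩, ⟨∑' x, F x, fun ε hε => ?_⟩, ?_⟩
  · have hs : Summable fun x : ℤ => |cov[u, v ∘ chainShift x; μ ε]| :=
      Summable.of_nonneg_of_le (fun x => abs_nonneg _) (hbound ε hε) hFs
    exact ⟨hs, hs.tsum_le_tsum (hbound ε hε) hFs⟩
  · -- (iii): termwise continuity + the uniform majorant
    refine continuousOn_tsum (fun x => ?_) hFs fun x ε hε => by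
      rw [Real.norm_eq_abs]; exact hbound ε hε x
    have hvx : v ∘ chainShift x ∈ _ := polyObs_comp_chainShift_mem hv x
    have huvx := mul_mem hu hvx
    have h1 := pencil_expectation_continuous' hω ha hb hμ huvx
    have h2 := pencil_expectation_continuous' hω ha hb hμ hu
    have h3 := pencil_expectation_continuous' hω ha hb hμ hvx
    refine (h1.sub (h2.mul h3)).congr fun ε hε => ?_
    haveI := hprob ε hε
    have hvx2 : MemLp (v ∘ chainShift x) 2 (μ ε) := (hv2 ε hε).1.comp_measurePreserving (hτ ε hε x)
    show cov[u, v ∘ chainShift x; μ ε] = _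
    rw [covariance_eq_sub (hu2 ε hε).1 hvx2]
    rfl

end Summit.AtomisticToContinuum.FouriersLaw.Theorems.DrudeDissolution.GramPencilHarmonicChaos

end
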